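import Mathlib.LinearAlgebra.Matrix.Trace
import Literature.Computability.AlgebraicComplexity.StandardFamilies
import HarnessLib

/-!
# Layered automata are projections of the iterated matrix multiplication polynomial

(N. Limaye, S. Srinivasan, S. Tavenas, J. ACM 72 (2025), Art. 26 = FOCS 2021, §8, proof of
Lemma 8: "It is a standard fact (and easy to see) that since the polynomial `P_w` is computed by a
set-multilinear ABP of width at most `2^b`, it is a set-multilinear restriction of
`IMM_{2^b,d}` … there are maps `ρ_p : X_p → X(w_p)` such that applying these linear
substitutions to all the variables in `IMM_{n,d}` yields the polynomial `P_w`.")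

This file proves the "standard fact" once and for all, for the tree's trace form
`immPoly n d K = tr (X^{(0)} ⋯ X^{(d-1)})` (`StandardFamilies.lean`) and an abstract *layered
automaton* reading one letter per layer:

* layers `t = 0, …, d`, state types `St t`, a start state `start : St 0`, finite input
  alphabets `In t` (`t : Fin d`), and partial transitions
  `step t : St t → In t → Option (St (t + 1))`; `run t w` is the state reached after reading the
  first `t` letters of `w : Π t, In t` (`none` = rejected);
* given encodings `enc t : St t → Fin n` that are injective, the substitution `autSubst` sends
  the `IMM` variable `x^{(t)}_{e,e'}` to the sum of the letters `X ⟨t, b⟩` labelling a transition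
  from the state encoded by `e` to the state encoded by `e'` (at the last layer: to *any* state,
  routed back to the column of the start state, which closes the walks of the trace);
* **`aeval_autSubst_immPoly`**: `aeval autSubst (immPoly n d K) = ∑_{w accepted} ∏_t X ⟨t, w t⟩`
  for `0 < d`.

Each `autSubst (t, e, e')` is a linear form in the letters of layer `t`, so the substitution is
block-preserving in the sense of `SetMultilinear.lean` (proved where it is used). The width
requirement `|St t| ≤ n` is exactly the existence of the injections `enc t`.

## Proof

`aeval` is a ring homomorphism, so it maps `tr (∏_t X^{(t)})` to `tr (∏_t A_t)` with
`A_t = (autSubst (t, ·, ·))` (`aeval_immPoly_eq_trace`). By induction on `t < d`,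
`(A_0 ⋯ A_{t-1})_{src, e}`
`  = ∑_{w : letters ≥ t defaulted} [run t w = some s, enc s = e] ∏_{i<t} X ⟨i, w i⟩`
(`prefixProd_apply_src`); the last matrix has a single nonzero column `src`, so the trace is
the `(src, src)` entry of the full product, which is the sum over accepted words.

## References

* N. Limaye, S. Srinivasan, S. Tavenas, J. ACM 72 (2025), Art. 26, §8, Lemma 22 and the proof
  of Lemma 8 (p. 26:21).
-/

noncomputable section

open MvPolynomial Matrix

namespace Literature.Computability.AlgebraicComplexity

namespace LayeredAutomaton

universe u

/-! ### Runs -/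

section Runs

variable {d : ℕ} {St : ℕ → Type} {In : Fin d → Type}

/-- The state reached after reading the first `t` letters of the word `w` (`none` if some
transition was undefined; junk `none` for `t > d`).
[cite: LimayeSrinivasanTavenas2025, Lemma 22] -/
def run (start : St 0) (step : (t : Fin d) → St t → In t → Option (St (t.val + 1)))
    (w : (t : Fin d) → In t) : (t : ℕ) → Option (St t)
  | 0 => some start
  | t + 1 => (run start step w t).bind fun s =>
      if h : t < d then step ⟨t, h⟩ s (w ⟨t, h⟩) else none

variable (start : St 0) (step : (t : Fin d) → St t → In t → Option (St (t.val + 1)))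

/-- Unfolding `run` at a successor layer inside the range.
[cite: LimayeSrinivasanTavenas2025, Lemma 22] -/
theorem run_succ (w : (t : Fin d) → In t) (t : ℕ) (h : t < d) :
    run start step w (t + 1) = (run start step w t).bind fun s => step ⟨t, h⟩ s (w ⟨t, h⟩) := by
  simp only [run, dif_pos h]

/-- The run up to layer `t` only reads the letters before `t`.
[cite: LimayeSrinivasanTavenas2025, Lemma 22] -/
theorem run_congr {w w' : (t : Fin d) → In t} (t : ℕ)
    (h : ∀ i : Fin d, (i : ℕ) < t → w i = w' i) : run start step w t = run start step w' t := by
  induction t with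
  | zero => rfl
  | succ t ih =>
    simp only [run]
    rw [ih fun i hi => h i (Nat.lt_succ_of_lt hi)]
    by_cases ht : t < d
    · simp only [dif_pos ht, h ⟨t, ht⟩ (Nat.lt_succ_self t)]
    · simp only [dif_neg ht]

/-- A word is *accepted* if the run through all `d` layers is defined.
[cite: LimayeSrinivasanTavenas2025, Lemma 22] -/
def Accepts (w : (t : Fin d) → In t) : Prop := (run start step w d).isSome

/-- Acceptance is decidable (it is the definedness of an `Option`). [folklore] -/
instance (w : (t : Fin d) → In t) : Decidable (Accepts start step w) := by
  unfold Accepts; infer_instance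

/-- Unfolding the accepted-word predicate. [cite: LimayeSrinivasanTavenas2025, Lemma 22] -/
theorem accepts_iff (w : (t : Fin d) → In t) :
    Accepts start step w ↔ ∃ s, run start step w d = some s := by
  unfold Accepts
  exact Option.isSome_iff_exists

/-- Runs at (propositionally) equal layers have the same definedness. [folklore] -/
theorem isSome_run_congr (w : (t : Fin d) → In t) {t t' : ℕ} (h : t = t') :
    (run start step w t).isSome = (run start step w t').isSome := by
  subst h; rfl

end Runs

/-! ### The substitution -/

section Subst

variable {K : Type u} [CommSemiring K]
variable {d n : ℕ} {St : ℕ → Type} [∀ t, Fintype (St t)]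
variable {In : Fin d → Type} [∀ t, Fintype (In t)] [∀ t, DecidableEq (In t)]
  [∀ t, Inhabited (In t)]
variable (start : St 0) (step : (t : Fin d) → St t → In t → Option (St (t.val + 1)))
variable (enc : (t : ℕ) → St t → Fin n)

/-- The column to which the last layer is routed: the encoding of the start state.
[cite: LimayeSrinivasanTavenas2025, Lemma 22] -/
def src : Fin n := enc 0 start

/-- `Trans t e b e'`: some state encoded by `e` at layer `t` reads the letter `b` and moves to a
state encoded by `e'` at layer `t + 1` — except at the last layer `t = d - 1`, where the target
is replaced by the fixed column `src` ("identifying all the vertices on layer `d`", LST 2025,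
proof of Lemma 22). [cite: LimayeSrinivasanTavenas2025, Lemma 22] -/
def Trans (t : Fin d) (e : Fin n) (b : In t) (e' : Fin n) : Prop :=
  ∃ s : St t, enc t s = e ∧ ∃ s' : St (t.val + 1), step t s b = some s' ∧
    (if t.val + 1 < d then enc (t.val + 1) s' = e' else e' = src start enc)

/-- `Trans` is decidable (finitely many states). [folklore] -/
instance (t : Fin d) (e : Fin n) (b : In t) (e' : Fin n) :
    Decidable (Trans start step enc t e b e') := by
  unfold Trans; exact Fintype.decidableExistsFintype

/-- **The substitution** `x^{(t)}_{e,e'} ↦ ∑_{b : Trans t e b e'} X ⟨t, b⟩`: the `IMM` variable of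
layer `t` at position `(e, e')` becomes the sum of the letters labelling transitions `e → e'`
(the linear substitutions `ρ_p` of LST 2025, proof of Lemma 8).
[cite: LimayeSrinivasanTavenas2025, Lemma 8] -/
def autSubst (v : Fin d × Fin n × Fin n) : MvPolynomial (Σ t : Fin d, In t) K :=
  ∑ b : In v.1, if Trans start step enc v.1 v.2.1 b v.2.2 then X ⟨v.1, b⟩ else 0

/-! ### `aeval` of `immPoly` is a trace of a matrix product -/

omit [∀ t, Fintype (St t)] [∀ t, Fintype (In t)]
  [∀ t, DecidableEq (In t)] [∀ t, Inhabited (In t)] in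
/-- For any substitution `g`, `aeval g (IMM_{n,d}) = tr (∏_t (g (t, ·, ·)))`: `aeval` is a ring
homomorphism, so it passes through the trace and the matrix product.
[cite: LimayeSrinivasanTavenas2025, §2.2] -/
theorem aeval_immPoly_eq_trace {S : Type*} [CommSemiring S] [Algebra K S]
    (g : Fin d × Fin n × Fin n → S) :
    aeval g (immPoly n d K) =
      Matrix.trace ((List.finRange d).map fun t => Matrix.of fun i j => g (t, i, j)).prod := by
  unfold immPoly immMatrix
  rw [AddMonoidHom.map_trace (aeval g)]
  congr 1
  rw [← AlgHom.mapMatrix_apply (aeval g), map_list_prod, List.map_map]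
  congr 1
  refine List.map_congr_left fun t _ => ?_
  ext i j
  simp [Matrix.map_apply, Matrix.mvPolynomialX_apply]

/-! ### The prefix products and the invariant -/

/-- The layer matrices `A_t = (autSubst (t, ·, ·))`, padded by `1` beyond `d`.
[cite: LimayeSrinivasanTavenas2025, Lemma 22] -/
def layerMat (t : ℕ) : Matrix (Fin n) (Fin n) (MvPolynomial (Σ t : Fin d, In t) K) :=
  if h : t < d then Matrix.of fun e e' => autSubst (K := K) start step enc (⟨t, h⟩, e, e') else 1

/-- The prefix products `A_0 ⋯ A_{t-1}`. [cite: LimayeSrinivasanTavenas2025, Lemma 22] -/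
def prefixProd (t : ℕ) : Matrix (Fin n) (Fin n) (MvPolynomial (Σ t : Fin d, In t) K) :=
  ((List.range t).map (layerMat (K := K) start step enc)).prod

omit [∀ t, DecidableEq (In t)] [∀ t, Inhabited (In t)] in
/-- The full product over the layers is the product of the layer matrices.
[cite: LimayeSrinivasanTavenas2025, Lemma 22] -/
theorem finRange_map_prod_eq_prefixProd :
    ((List.finRange d).map fun t : Fin d =>
        Matrix.of fun i j => autSubst (K := K) start step enc (t, i, j)).prod =
      prefixProd (K := K) start step enc d := by
  unfold prefixProd
  congr 1
  apply List.ext_getElem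
  · simp
  · intro i h₁ h₂
    rw [List.getElem_map, List.getElem_map, List.getElem_finRange, List.getElem_range, layerMat,
      dif_pos (by simpa using h₁)]
    rfl

/-- `range` of a positive number ends with its predecessor. [folklore] -/
theorem range_eq_range_pred_append {m : ℕ} (hm : 0 < m) :
    List.range m = List.range (m - 1) ++ [m - 1] := by
  obtain ⟨m', rfl⟩ := Nat.exists_eq_succ_of_ne_zero hm.ne'
  simp [List.range_succ]

/-- The words whose letters from layer `t` on are the default letter (encoding the prefixes of
length `t`). [folklore] -/
def prefixWords (t : ℕ) : Finset ((i : Fin d) → In i) :=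
  Finset.univ.filter fun w => ∀ i : Fin d, t ≤ (i : ℕ) → w i = default

/-- The monomial of the first `t` letters of `w`. [folklore] -/
def prefixMono (t : ℕ) (w : (i : Fin d) → In i) : MvPolynomial (Σ t : Fin d, In t) K :=
  ∏ i ∈ Finset.univ.filter (fun i : Fin d => (i : ℕ) < t), X ⟨i, w i⟩

/-- All words are prefixes of any length `≥ d`. [folklore] -/
theorem prefixWords_eq_univ {t : ℕ} (ht : d ≤ t) : prefixWords (In := In) t = Finset.univ := by
  ext w
  simp only [prefixWords, Finset.mem_filter, Finset.mem_univ, true_and, iff_true]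
  intro i hi
  exact absurd i.2 (by omega)

omit [∀ t, Fintype (St t)] [∀ t, Fintype (In t)]
  [∀ t, DecidableEq (In t)] [∀ t, Inhabited (In t)] in
/-- The monomial of length `≥ d` is the product of all letters. [folklore] -/
theorem prefixMono_eq_prod {t : ℕ} (ht : d ≤ t) (w : (i : Fin d) → In i) :
    prefixMono (K := K) t w = ∏ i : Fin d, X ⟨i, w i⟩ := by
  unfold prefixMono
  congr 1
  ext i
  simp only [Finset.mem_filter, Finset.mem_univ, true_and, iff_true]
  omega

/-- Extending a defaulted word by one letter. [folklore] -/
theorem update_mem_prefixWords {t : ℕ} (ht : t < d) {w : (i : Fin d) → In i}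
    (hw : w ∈ prefixWords t) (b : In ⟨t, ht⟩) :
    Function.update w ⟨t, ht⟩ b ∈ prefixWords (t + 1) := by
  simp only [prefixWords, Finset.mem_filter, Finset.mem_univ, true_and] at hw ⊢
  intro i hi
  rw [Function.update_of_ne (fun h => by subst h; simp at hi)]
  exact hw i (by omega)

/-- Resetting the last letter of a defaulted word. [folklore] -/
theorem update_default_mem_prefixWords {t : ℕ} (ht : t < d) {w : (i : Fin d) → In i}
    (hw : w ∈ prefixWords (t + 1)) : Function.update w ⟨t, ht⟩ default ∈ prefixWords t := by
  simp only [prefixWords, Finset.mem_filter, Finset.mem_univ, true_and] at hw ⊢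
  intro i hi
  by_cases h : i = ⟨t, ht⟩
  · subst h; simp
  · rw [Function.update_of_ne h]
    refine hw i ?_
    have : (i : ℕ) ≠ t := fun h' => h (Fin.ext h')
    omega

omit [∀ t, Fintype (St t)] [∀ t, Fintype (In t)]
  [∀ t, DecidableEq (In t)] [∀ t, Inhabited (In t)] in
/-- The monomial of `t + 1` letters of an updated word. [folklore] -/
theorem prefixMono_succ_update {t : ℕ} (ht : t < d) (w : (i : Fin d) → In i) (b : In ⟨t, ht⟩) :
    prefixMono (K := K) (t + 1) (Function.update w ⟨t, ht⟩ b) =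
      prefixMono (K := K) t w * X ⟨⟨t, ht⟩, b⟩ := by
  unfold prefixMono
  have hsplit : (Finset.univ.filter fun i : Fin d => (i : ℕ) < t + 1) =
      insert ⟨t, ht⟩ (Finset.univ.filter fun i : Fin d => (i : ℕ) < t) := by
    ext i
    simp only [Finset.mem_filter, Finset.mem_univ, true_and, Finset.mem_insert, Fin.ext_iff]
    omega
  have hnot : (⟨t, ht⟩ : Fin d) ∉ (Finset.univ.filter fun i : Fin d => (i : ℕ) < t) := by simp
  rw [hsplit, Finset.prod_insert hnot, mul_comm, Function.update_self]
  congr 1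
  refine Finset.prod_congr rfl fun i hi => ?_
  rw [Finset.mem_filter] at hi
  rw [Function.update_of_ne]
  intro h; subst h; simp at hi

/-- The generating function of the runs of length `t` ending in the state encoded by `e`:
`∑_{w : prefixes of length t} [run t w = some s, enc s = e] ∏_{i<t} X ⟨i, w i⟩` (the polynomial
`P_{v_τ}` "computed from the source node to `v_τ`", LST 2025, proof of Lemma 22).
[cite: LimayeSrinivasanTavenas2025, Lemma 22] -/
def runPoly (t : ℕ) (e : Fin n) : MvPolynomial (Σ t : Fin d, In t) K :=
  ∑ w ∈ prefixWords t,
    if ∃ s, run start step w t = some s ∧ enc t s = e then prefixMono (K := K) t w else 0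

variable (henc : ∀ t, t ≤ d → Function.Injective (enc t))
include henc

/-- **One layer of the invariant**: multiplying the generating row vector of the runs of length
`t` by the transition forms of layer `t` gives the generating function of the runs of length
`t + 1` (for any decidable condition `Q` on the target state — used with `Q = (enc · = e')` for
the inner layers and `Q = ⊤` for the last one). [cite: LimayeSrinivasanTavenas2025, Lemma 22] -/
theorem sum_runPoly_mul_trans {t : ℕ} (ht : t < d) (Q : St (t + 1) → Prop) [DecidablePred Q] :
    (∑ e : Fin n, runPoly (K := K) start step enc t e *
      ∑ b : In ⟨t, ht⟩, (if ∃ s : St t, enc t s = e ∧ ∃ s', step ⟨t, ht⟩ s b = some s' ∧ Q s'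
        then X ⟨⟨t, ht⟩, b⟩ else 0)) =
    ∑ w ∈ prefixWords (t + 1),
      (if ∃ s', run start step w (t + 1) = some s' ∧ Q s' then prefixMono (K := K) (t + 1) w
        else 0) := by
  classical
  -- the summand of the right-hand side, as a function of the updated word
  set H : ((i : Fin d) → In i) → MvPolynomial (Σ t : Fin d, In t) K := fun w' =>
    if ∃ s', run start step w' (t + 1) = some s' ∧ Q s' then prefixMono (K := K) (t + 1) w'
      else 0 with hH
  -- Step 1: for fixed `w`, the sum over `e` has at most one nonzero term, `e = enc t s`
  have step1 : ∀ w ∈ prefixWords t,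
      (∑ e : Fin n, (if ∃ s, run start step w t = some s ∧ enc t s = e
          then prefixMono (K := K) t w else 0) *
        ∑ b : In ⟨t, ht⟩, (if ∃ s : St t, enc t s = e ∧ ∃ s', step ⟨t, ht⟩ s b = some s' ∧ Q s'
          then X ⟨⟨t, ht⟩, b⟩ else 0)) =
      ∑ b : In ⟨t, ht⟩, H (Function.update w ⟨t, ht⟩ b) := by
    intro w _
    have hrun : ∀ b : In ⟨t, ht⟩, run start step (Function.update w ⟨t, ht⟩ b) (t + 1) =
        (run start step w t).bind fun s => step ⟨t, ht⟩ s b := by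
      intro b
      rw [run_succ start step _ t ht]
      simp only [Function.update_self]
      rw [run_congr start step t (fun i hi => Function.update_of_ne
          (fun h => by subst h; simp at hi) _ _)]
    cases hr : run start step w t with
    | none =>
      have h0 : ∀ b : In ⟨t, ht⟩, H (Function.update w ⟨t, ht⟩ b) = 0 := fun b => by
        simp only [hH, hrun b, hr, Option.bind_none]
        rw [if_neg]
        rintro ⟨s', hs', -⟩
        exact absurd hs' (by simp)
      simp only [h0, Finset.sum_const_zero]
      refine Finset.sum_eq_zero fun e _ => ?_
      rw [if_neg, zero_mul]
      rintro ⟨s, hs, -⟩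
      exact absurd hs (by simp)
    | some s =>
      rw [Finset.sum_eq_single (enc t s)]
      · rw [if_pos ⟨s, rfl, rfl⟩, Finset.mul_sum]
        refine Finset.sum_congr rfl fun b _ => ?_
        simp only [hH, hrun b, hr, Option.bind_some, prefixMono_succ_update]
        by_cases hq : ∃ s', step ⟨t, ht⟩ s b = some s' ∧ Q s'
        · rw [if_pos ⟨s, rfl, hq⟩, if_pos hq]
        · rw [if_neg, if_neg hq, mul_zero]
          rintro ⟨s₁, hs₁, hq₁⟩
          exact hq (henc t ht.le hs₁ ▸ hq₁)
      · intro e _ hne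
        rw [if_neg, zero_mul]
        rintro ⟨s₁, hs₁, rfl⟩
        exact hne (by rw [Option.some.inj hs₁])
      · intro h; exact absurd (Finset.mem_univ _) h
  -- Step 2: swap the two outer sums and apply Step 1
  unfold runPoly
  simp_rw [Finset.sum_mul]
  rw [Finset.sum_comm]
  rw [Finset.sum_congr rfl step1]
  -- Step 3: reindex the pairs `(w, b)` by the updated words
  rw [← Finset.sum_product' (f := fun w b => H (Function.update w ⟨t, ht⟩ b))]
  refine Finset.sum_nbij' (fun p => Function.update p.1 ⟨t, ht⟩ p.2)
    (fun w' => (Function.update w' ⟨t, ht⟩ default, w' ⟨t, ht⟩)) ?_ ?_ ?_ ?_ ?_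
  · rintro ⟨w, b⟩ hp
    rw [Finset.mem_product] at hp
    exact update_mem_prefixWords ht hp.1 b
  · intro w' hw'
    rw [Finset.mem_product]
    exact ⟨update_default_mem_prefixWords ht hw', Finset.mem_univ _⟩
  · rintro ⟨w, b⟩ hp
    rw [Finset.mem_product] at hp
    have hw := hp.1
    simp only [prefixWords, Finset.mem_filter, Finset.mem_univ, true_and] at hw
    refine Prod.ext ?_ ?_
    · simp only [Function.update_idem, Function.update_eq_self_iff]
      exact (hw _ le_rfl).symm
    · simp
  · intro w' _
    simp
  · intro p _
    rfl

/-- **The invariant** (LST 2025, proof of Lemma 22: the polynomial computed from the source to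
the vertex `v_τ` of layer `i` is the sum over the accepted prefixes reaching it): for `t < d`,
`(A_0 ⋯ A_{t-1})_{src, e} = runPoly t e`
`  = ∑_{w : prefixes of length t} [run t w = some s, enc s = e] ∏_{i<t} X ⟨i, w i⟩`.
[cite: LimayeSrinivasanTavenas2025, Lemma 22] -/
theorem prefixProd_apply_src {t : ℕ} (ht : t < d) (e : Fin n) :
    prefixProd (K := K) start step enc t (src start enc) e =
      runPoly (K := K) start step enc t e := by
  classical
  induction t generalizing e with
  | zero =>
    -- `prefixProd 0 = 1`; the only prefix of length `0` is the default word, in state `start`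
    unfold prefixProd runPoly
    simp only [List.range_zero, List.map_nil, List.prod_nil]
    have hpw : prefixWords (In := In) 0 = {fun i => default} := by
      ext w
      simp only [prefixWords, Finset.mem_filter, Finset.mem_univ, true_and, zero_le,
        forall_const, Finset.mem_singleton]
      exact ⟨fun h => funext h, fun h i => by rw [h]⟩
    rw [hpw, Finset.sum_singleton, Matrix.one_apply]
    have hmono : prefixMono (K := K) 0 (fun i : Fin d => (default : In i)) = 1 := by
      unfold prefixMono
      rw [Finset.prod_eq_one]
      intro i hi
      simp at hi
    by_cases h : enc 0 start = e
    · rw [if_pos (show src start enc = e from h), if_pos ⟨start, rfl, h⟩, hmono]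
    · rw [if_neg (show ¬ src start enc = e from h), if_neg]
      rintro ⟨s, hs, hse⟩
      exact h ((Option.some.inj hs).symm ▸ hse)
  | succ t ih =>
    have ht' : t < d := Nat.lt_of_succ_lt ht
    unfold prefixProd
    rw [List.range_succ, List.map_append, List.map_singleton, List.prod_append,
      List.prod_singleton, ← prefixProd, Matrix.mul_apply]
    simp_rw [ih ht']
    rw [layerMat, dif_pos ht']
    simp only [Matrix.of_apply, autSubst, Trans, if_pos ht]
    rw [sum_runPoly_mul_trans (K := K) start step enc henc ht' (fun s' => enc (t + 1) s' = e)]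
    rfl

omit [∀ t, DecidableEq (In t)] [∀ t, Inhabited (In t)] henc in
/-- The last layer matrix has a single nonzero column, `src`.
[cite: LimayeSrinivasanTavenas2025, Lemma 22] -/
theorem layerMat_last_apply_of_ne (hd : 0 < d) {e i : Fin n} (hi : i ≠ src start enc) :
    layerMat (K := K) start step enc (d - 1) e i = 0 := by
  unfold layerMat
  rw [dif_pos (Nat.sub_lt hd Nat.one_pos)]
  simp only [Matrix.of_apply, autSubst]
  refine Finset.sum_eq_zero fun b _ => ?_
  rw [if_neg]
  rintro ⟨s, -, s', -, h⟩
  have hnot : ¬ ((⟨d - 1, Nat.sub_lt hd Nat.one_pos⟩ : Fin d).val + 1 < d) := by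
    dsimp only; omega
  rw [if_neg hnot] at h
  exact hi h

/-- **A layered automaton is a projection of `IMM`** (LST 2025, §8, proof of Lemma 8: "since the
polynomial `P_w` is computed by a set-multilinear ABP of width at most `2^b`, it is a
set-multilinear restriction of `IMM_{2^b,d}`"): for `0 < d` and injective state encodings into
`Fin n`, substituting `autSubst` into `immPoly n d K` yields the sum, over the accepted words `w`,
of the monomials `∏_t X ⟨t, w t⟩`. [cite: LimayeSrinivasanTavenas2025, Lemma 8] -/
theorem aeval_autSubst_immPoly (hd : 0 < d) :
    aeval (autSubst (K := K) start step enc) (immPoly n d K) =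
      ∑ w : (t : Fin d) → In t, if Accepts start step w then ∏ t : Fin d, X ⟨t, w t⟩ else 0 := by
  classical
  rw [aeval_immPoly_eq_trace, finRange_map_prod_eq_prefixProd]
  -- split off the last layer
  have hd'lt : d - 1 < d := Nat.sub_lt hd Nat.one_pos
  have hlast : prefixProd (K := K) start step enc d =
      prefixProd (K := K) start step enc (d - 1) * layerMat (K := K) start step enc (d - 1) := by
    unfold prefixProd
    rw [range_eq_range_pred_append hd, List.map_append, List.map_singleton, List.prod_append,
      List.prod_singleton]
  rw [hlast, Matrix.trace]
  simp only [Matrix.diag_apply, Matrix.mul_apply]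
  -- only the diagonal entry at `src` survives
  rw [Finset.sum_eq_single (src start enc)]
  · simp_rw [prefixProd_apply_src (K := K) start step enc henc hd'lt]
    rw [layerMat, dif_pos hd'lt]
    simp only [Matrix.of_apply, autSubst, Trans]
    have hlt : ¬ ((⟨d - 1, hd'lt⟩ : Fin d).val + 1 < d) := by dsimp only; omega
    simp only [if_neg hlt, and_true]
    have key := sum_runPoly_mul_trans (K := K) start step enc henc hd'lt (fun _ => True)
    simp only [and_true] at key
    rw [key, prefixWords_eq_univ (by omega)]
    refine Finset.sum_congr rfl fun w _ => ?_
    rw [prefixMono_eq_prod (by omega)]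
    have hacc : (∃ s', run start step w (d - 1 + 1) = some s') ↔ Accepts start step w := by
      rw [← Option.isSome_iff_exists, isSome_run_congr start step w (Nat.sub_add_cancel hd)]
      rfl
    simp only [hacc]
  · intro i _ hi
    refine Finset.sum_eq_zero fun e _ => ?_
    rw [layerMat_last_apply_of_ne (K := K) start step enc hd hi, mul_zero]
  · intro h; exact absurd (Finset.mem_univ _) h

end Subst

end LayeredAutomaton

end Literature.Computability.AlgebraicComplexity
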